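import Literature.NumberTheory.Transcendental.QuadraticRelationsLogarithmsSec6Thm11
import Literature.NumberTheory.Transcendental.QuadraticRelationsLogarithmsThm11
import HarnessLib

/-!
# Roy–Waldschmidt 1997: Théorème 0.2 from Théorème 5.1 — final assembly

D. Roy, M. Waldschmidt, Ann. Sci. ÉNS (4) 30 (1997) 753–796.

1. **Reduction to `K` finitely generated of transcendence degree `1`** (§6 (iv) (b), p. 789: "Dans
   l'énoncé du théorème 1.1, on peut supposer sans perte de généralité que `K` est de type fini sur
   `ℚ`, de degré de transcendance `1`"): `thm_1_1_of_thm_5_1` — Théorème 1.1 for every subfield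
   `K ⊆ ℂ` of transcendence degree `1`, from Théorème 5.1 (hypothesis `h51`, tangent-space form of
   `…Sec6IVa.lean`) for the finitely generated subfields of transcendence degree `1`.
2. **Corollaire 1.3 from Théorème 1.1 at transcendence degree `1`**: `cor_1_3_case_b_eq`,
   `cor_1_3_of_thm_1_1_eq` — the proofs of `…Thm11.lean` (`cor_1_3_case_b`, `cor_1_3_of_thm_1_1`),
   which use Théorème 1.1 only for the field `K` of Corollaire 1.3 itself, with the hypothesis
   restricted accordingly.
3. `royWaldschmidt_quadratic_thm_0_2_of_thm_5_1` — **the named fact from Théorème 5.1 alone**.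

No definitions, no named facts.

## References

* [RoyWaldschmidt1997ENS] D. Roy, M. Waldschmidt, Ann. Sci. ÉNS (4) 30 (1997) 753–796:
  Théorème 1.1 pp. 755–756, Corollaire 1.3 p. 759, Théorème 5.1 p. 779, §6 (iv) (b) pp. 789–790.
-/

noncomputable section

open Complex IntermediateField Module Submodule

namespace Literature.NumberTheory.Transcendental

namespace RoyWaldschmidt1997

open LiePresentation

variable {K : IntermediateField ℚ ℂ} {d₀ d₁ : ℕ}

/-! ### Finitely generated subfields of transcendence degree `1` -/

/-- A subfield `K ⊆ ℂ` of transcendence degree `1` over `ℚ` contains, for every finite `S ⊆ K`, a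
finitely generated subfield `K₁ ⊇ S` of transcendence degree `1`. [folklore] -/
theorem exists_fg_subfield (hK : Algebra.trdeg ℚ K = 1) (S : Finset ℂ) (hS : ∀ x ∈ S, x ∈ K) :
    ∃ K₁ : IntermediateField ℚ ℂ, K₁ ≤ K ∧ K₁.FG ∧ Algebra.trdeg ℚ K₁ = 1 ∧ ∀ x ∈ S, x ∈ K₁ := by
  classical
  have htr : Algebra.Transcendental ℚ K := trdeg_ne_zero_iff.mp (by rw [hK]; exact one_ne_zero)
  obtain ⟨t, ht⟩ := Algebra.transcendental_def.mp htr
  have htC : Transcendental ℚ ((t : K) : ℂ) :=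
    (transcendental_algebraMap_iff (algebraMap K ℂ).injective).mpr ht
  set K₁ : IntermediateField ℚ ℂ := IntermediateField.adjoin ℚ (↑(insert (t : ℂ) S) : Set ℂ) with hK₁
  have hle : K₁ ≤ K := by
    rw [hK₁, IntermediateField.adjoin_le_iff]
    intro x hx
    rw [Finset.coe_insert, Set.mem_insert_iff] at hx
    rcases hx with rfl | hx
    · exact t.2
    · exact hS x hx
  have hmem : ∀ x ∈ insert (t : ℂ) S, x ∈ K₁ := fun x hx =>
    IntermediateField.subset_adjoin ℚ _ (by exact_mod_cast hx)
  refine ⟨K₁, hle, IntermediateField.fg_adjoin_finset _, ?_, fun x hx => hmem x (Finset.mem_insert_of_mem hx)⟩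
  refine le_antisymm ?_ ?_
  · rw [← hK]
    exact trdeg_le_of_injective (IntermediateField.inclusion hle) (IntermediateField.inclusion_injective hle)
  · have ht₁ : Transcendental ℚ (⟨(t : ℂ), hmem _ (Finset.mem_insert_self _ _)⟩ : K₁) := by
      refine (transcendental_algebraMap_iff (algebraMap K₁ ℂ).injective).mp ?_
      exact htC
    haveI : Algebra.Transcendental ℚ K₁ := Algebra.transcendental_def.mpr ⟨_, ht₁⟩
    exact Cardinal.one_le_iff_pos.mpr (trdeg_pos ℚ K₁)

/-! ### Spans of vectors with coordinates in a subfield -/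

/-- For vectors with coordinates in `F`, the `F`-span and the `ℂ`-span have the same dimension. [folklore] -/
theorem finrank_span_eq_of_coords (F : IntermediateField ℚ ℂ) {r : ℕ}
    (u : Fin r → (Fin d₀ → ℂ) × (Fin d₁ → ℂ)) (hu : ∀ k, (∀ i, (u k).1 i ∈ F) ∧ (∀ j, (u k).2 j ∈ F)) :
    Module.finrank F (span F (Set.range u)) = Module.finrank ℂ (span ℂ (Set.range u)) := by
  classical
  set e := (LinearEquiv.sumArrowLequivProdArrow (Fin d₀) (Fin d₁) ℂ ℂ).symm with he
  let c : Fin r → (Fin d₀ ⊕ Fin d₁) → F := fun k => Sum.elim (fun i => ⟨(u k).1 i, (hu k).1 i⟩) (fun j => ⟨(u k).2 j, (hu k).2 j⟩)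
  have hec : ∀ k, e (u k) = ofK F (L := ℂ) (c k) := by
    intro k; funext s
    rcases s with i | j
    · rfl
    · rfl
  -- `F`-side
  have h1 : (span F (Set.range u)).map (e.restrictScalars F).toLinearMap = span F (Set.range (ofK F (L := ℂ) ∘ c)) := by
    rw [Submodule.map_span]; congr 1
    ext v; simp only [Set.mem_image, Set.mem_range]
    constructor
    · rintro ⟨_, ⟨k, rfl⟩, rfl⟩; exact ⟨k, (hec k).symm⟩
    · rintro ⟨k, rfl⟩; exact ⟨u k, ⟨k, rfl⟩, hec k⟩
  have h2 : (span F (Set.range c)).map (Pi.algebraMap (Fin d₀ ⊕ Fin d₁) F ℂ) = span F (Set.range (ofK F (L := ℂ) ∘ c)) := by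
    rw [Submodule.map_span]; congr 1
    ext v; simp only [Set.mem_image, Set.mem_range]
    constructor
    · rintro ⟨_, ⟨k, rfl⟩, rfl⟩; exact ⟨k, rfl⟩
    · rintro ⟨k, rfl⟩; exact ⟨c k, ⟨k, rfl⟩, rfl⟩
  have hinjφ : Function.Injective (Pi.algebraMap (Fin d₀ ⊕ Fin d₁) F ℂ) :=
    fun v w h => ofK_injective F (L := ℂ) (σ := Fin d₀ ⊕ Fin d₁) h
  have hF : Module.finrank F (span F (Set.range u)) = Module.finrank F (span F (Set.range c)) := by
    rw [← finrank_map_of_injective (e.restrictScalars F).toLinearMap (e.restrictScalars F).injective, h1,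
      ← h2, finrank_map_of_injective _ hinjφ]
  -- `ℂ`-side
  have h3 : (span ℂ (Set.range u)).map e.toLinearMap = span ℂ (Set.range (ofK F (L := ℂ) ∘ c)) := by
    rw [Submodule.map_span]; congr 1
    ext v; simp only [Set.mem_image, Set.mem_range]
    constructor
    · rintro ⟨_, ⟨k, rfl⟩, rfl⟩; exact ⟨k, (hec k).symm⟩
    · rintro ⟨k, rfl⟩; exact ⟨u k, ⟨k, rfl⟩, hec k⟩
  have hC : Module.finrank ℂ (span ℂ (Set.range u)) = Module.finrank ℂ (span ℂ (Set.range (ofK F (L := ℂ) ∘ c))) := by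
    rw [← finrank_map_of_injective e.toLinearMap e.injective, h3]
  rw [hF, hC, ← finrank_span_ofK F (L := ℂ) (span F (Set.range c)), span_ofK_span F, Set.range_comp]

/-! ### Maps compatible with the `F`-structure and the `ℚ`-structure -/

/-- If `g(F^{d₀} × 0) ⊆ F^{d₀'} × 0` and `g(0 × ℚ^{d₁}) ⊆ 0 × ℚ^{d₁'}` then `g` maps `F`-points to
`F`-points. [folklore] -/
theorem coords_of_images (F : IntermediateField ℚ ℂ) {d₀' d₁' : ℕ}
    (g : ((Fin d₀ → ℂ) × (Fin d₁ → ℂ)) →ₗ[ℂ] ((Fin d₀' → ℂ) × (Fin d₁' → ℂ)))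
    (hF : g '' {p | (∀ i, p.1 i ∈ F) ∧ p.2 = 0} ⊆ {q | (∀ i, q.1 i ∈ F) ∧ q.2 = 0})
    (hQ : g '' {p | p.1 = 0 ∧ ∀ j, p.2 j ∈ Set.range ((↑) : ℚ → ℂ)} ⊆
      {q | q.1 = 0 ∧ ∀ j, q.2 j ∈ Set.range ((↑) : ℚ → ℂ)})
    (p : (Fin d₀ → ℂ) × (Fin d₁ → ℂ)) (hp : (∀ i, p.1 i ∈ F) ∧ (∀ j, p.2 j ∈ F)) :
    (∀ i, (g p).1 i ∈ F) ∧ (∀ j, (g p).2 j ∈ F) := by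
  classical
  have hsplit : p = (p.1, 0) + ∑ j, p.2 j • ((0 : Fin d₀ → ℂ), (Pi.single j (1 : ℂ) : Fin d₁ → ℂ)) := by
    ext i
    · simp [Prod.fst_sum]
    · simp [Prod.snd_sum, Finset.sum_apply, Pi.single_apply]
  have h1 : (∀ i, (g (p.1, 0)).1 i ∈ F) ∧ (g (p.1, 0)).2 = 0 := hF ⟨(p.1, 0), ⟨hp.1, rfl⟩, rfl⟩
  have h2 : ∀ j, (g ((0 : Fin d₀ → ℂ), (Pi.single j (1 : ℂ) : Fin d₁ → ℂ))).1 = 0 ∧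
      ∀ l, (g ((0 : Fin d₀ → ℂ), (Pi.single j (1 : ℂ) : Fin d₁ → ℂ))).2 l ∈ F := by
    intro j
    obtain ⟨h0, hr⟩ := hQ ⟨(0, Pi.single j 1), ⟨rfl, fun l => ⟨(Pi.single j (1 : ℚ) : Fin d₁ → ℚ) l, by
      by_cases h : l = j
      · subst h; simp
      · simp [h]⟩⟩, rfl⟩
    refine ⟨h0, fun l => ?_⟩
    obtain ⟨q, hq⟩ := hr l
    rw [← hq]
    simp
  rw [hsplit, map_add, map_sum]
  simp only [map_smul]
  refine ⟨fun i => ?_, fun l => ?_⟩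
  · rw [Prod.fst_add, Prod.fst_sum, Pi.add_apply, Finset.sum_apply]
    refine add_mem (h1.1 i) (Subalgebra.sum_mem _ fun j _ => ?_)
    rw [Prod.smul_fst, (h2 j).1]; simp
  · rw [Prod.snd_add, Prod.snd_sum, Pi.add_apply, Finset.sum_apply, h1.2]
    refine add_mem (by simp) (Subalgebra.sum_mem _ fun j _ => ?_)
    rw [Prod.smul_snd, Pi.smul_apply, smul_eq_mul]
    exact mul_mem (hp.2 j) ((h2 j).2 l)

/-- The image condition `g(K^{d₀} × 0) = K^{d₀'} × 0` ascends from a subfield `K₁ ⊆ K`. [folklore] -/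
theorem image_kset_of_le {K₁ : IntermediateField ℚ ℂ} (hle : K₁ ≤ K) {d₀' d₁' : ℕ}
    (g : ((Fin d₀ → ℂ) × (Fin d₁ → ℂ)) →ₗ[ℂ] ((Fin d₀' → ℂ) × (Fin d₁' → ℂ)))
    (him : g '' {p | (∀ i, p.1 i ∈ K₁) ∧ p.2 = 0} = {q | (∀ i, q.1 i ∈ K₁) ∧ q.2 = 0}) :
    g '' {p | (∀ i, p.1 i ∈ K) ∧ p.2 = 0} = {q | (∀ i, q.1 i ∈ K) ∧ q.2 = 0} := by
  classical
  -- images of the basis vectors `(e_i, 0)`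
  have hb : ∀ i : Fin d₀, (∀ l, (g (Pi.single i 1, 0)).1 l ∈ K₁) ∧ (g (Pi.single i 1, 0)).2 = 0 := by
    intro i
    have : g (Pi.single i 1, 0) ∈ g '' {p : (Fin d₀ → ℂ) × (Fin d₁ → ℂ) | (∀ i, p.1 i ∈ K₁) ∧ p.2 = 0} :=
      ⟨_, ⟨fun l => by by_cases h : l = i <;> simp [h], rfl⟩, rfl⟩
    rw [him] at this
    exact this
  ext q
  constructor
  · rintro ⟨p, ⟨hp1, hp2⟩, rfl⟩
    have hp : p = ∑ i, p.1 i • ((Pi.single i (1 : ℂ) : Fin d₀ → ℂ), (0 : Fin d₁ → ℂ)) := by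
      ext l
      · simp [Prod.fst_sum, Finset.sum_apply, Pi.single_apply]
      · simp [Prod.snd_sum, hp2]
    rw [hp, map_sum]
    simp only [map_smul]
    refine ⟨fun l => ?_, ?_⟩
    · rw [Prod.fst_sum, Finset.sum_apply]
      exact Subalgebra.sum_mem _ fun i _ => by
        rw [Prod.smul_fst, Pi.smul_apply, smul_eq_mul]; exact mul_mem (hp1 i) (hle ((hb i).1 l))
    · rw [Prod.snd_sum]
      exact Finset.sum_eq_zero fun i _ => by rw [Prod.smul_snd, (hb i).2, smul_zero]
  · rintro ⟨hq1, hq2⟩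
    -- preimages of the `(e'_l, 0)`
    have hpre : ∀ l : Fin d₀', ∃ p : (Fin d₀ → ℂ) × (Fin d₁ → ℂ), ((∀ i, p.1 i ∈ K₁) ∧ p.2 = 0) ∧
        g p = (Pi.single l 1, 0) := by
      intro l
      have : ((Pi.single l (1 : ℂ) : Fin d₀' → ℂ), (0 : Fin d₁' → ℂ)) ∈
          {q : (Fin d₀' → ℂ) × (Fin d₁' → ℂ) | (∀ i, q.1 i ∈ K₁) ∧ q.2 = 0} :=
        ⟨fun i => by by_cases h : i = l <;> simp [h], rfl⟩
      rw [← him] at this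
      obtain ⟨p, hp, hpq⟩ := this
      exact ⟨p, hp, hpq⟩
    choose pre hpre1 hpre2 using hpre
    refine ⟨∑ l, q.1 l • pre l, ⟨fun i => ?_, ?_⟩, ?_⟩
    · rw [Prod.fst_sum, Finset.sum_apply]
      exact Subalgebra.sum_mem _ fun l _ => by
        rw [Prod.smul_fst, Pi.smul_apply, smul_eq_mul]; exact mul_mem (hq1 l) (hle ((hpre1 l).1 i))
    · rw [Prod.snd_sum]
      exact Finset.sum_eq_zero fun l _ => by rw [Prod.smul_snd, (hpre1 l).2, smul_zero]
    · rw [map_sum]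
      simp only [map_smul, hpre2]
      ext l
      · simp [Prod.fst_sum, Finset.sum_apply, Pi.single_apply]
      · simp [Prod.snd_sum, hq2]

/-! ### Théorème 1.1 for every subfield of transcendence degree `1` -/

set_option maxHeartbeats 1600000 in
/-- **Théorème 1.1 of Roy–Waldschmidt 1997** (pp. 755–756, verbatim as the hypothesis `h11` of
`…Thm11.lean`, for every subfield `K ⊆ ℂ` of transcendence degree `1` over `ℚ`), **deduced from
Théorème 5.1** for the finitely generated subfields of transcendence degree `1` (hypothesis `h51all`,
tangent-space form of `…Sec6IVa.lean`): the reduction "on peut supposer sans perte de généralité que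
`K` est de type fini sur `ℚ`, de degré de transcendance `1`" (p. 789) — replace `K` by the subfield
`K₁` generated by the coordinates of a `K`-basis of `W`, the coordinates and exponentials of
generators of `Y`, and a transcendental element, and `W` by the `K₁`-span `W₁` of that basis — followed
by `thm_1_1_of_h51` over `K₁`. [cite: RoyWaldschmidt1997ENS, Théorème 1.1 pp. 755–756; §6 (iv) (b) p. 789] -/
theorem thm_1_1_of_thm_5_1
    (h51all : ∀ (K : IntermediateField ℚ ℂ), K.FG → Algebra.trdeg ℚ K = 1 → ∀ X : RWObj K, 0 < X.d₀ + X.d₁ →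
      ∃ (d₀' d₁' : ℕ) (g : ((Fin X.d₀ → ℂ) × (Fin X.d₁ → ℂ)) →ₗ[ℂ] ((Fin d₀' → ℂ) × (Fin d₁' → ℂ))),
        IsStruct K g ∧ Function.Surjective g ∧
        (∀ z : Fin X.d₁ → ℤ, ∃ z' : Fin d₁' → ℤ, g (0, fun j => (z j : ℂ)) = (0, fun j => (z' j : ℂ))) ∧
        0 < d₀' + d₁' ∧
        ∀ ε : ℝ, 0 < ε → ε ≤ 1 / (2 * ((X.d₀ : ℝ) + X.d₁) * (((X.d₀ : ℝ) + X.d₁) + ((X.ell₁ : ℝ) - X.kap)) + 1) →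
          ((((X.d₀ : ℝ) + X.d₁) - 2 * X.nn) + ε * ((X.nn : ℝ) - X.d₀)) *
              ((d₁' : ℝ) + ((Module.finrank ℤ ↥(X.Y.map (g.restrictScalars ℤ)) : ℝ) -
                Module.finrank ℤ ↥(X.Y.map (g.restrictScalars ℤ) ⊓ omegaLattice d₀' d₁'))) ≤
            (X.d₁ : ℝ) * ((((d₀' : ℝ) + d₁') - Module.finrank K ↥(X.W.map (g.restrictScalars K))) +
              ε * ((Module.finrank K ↥(X.W.map (g.restrictScalars K)) : ℝ) - d₀') -
              ε ^ 2 * ((Module.finrank ℤ ↥(X.Ya.map (g.restrictScalars ℤ)) : ℝ) -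
                Module.finrank ℤ ↥(X.Ya.map (g.restrictScalars ℤ) ⊓ omegaLattice d₀' d₁'))))
    (K : IntermediateField ℚ ℂ) (hK : Algebra.trdeg ℚ K = 1)
    (d₀ d₁ : ℕ) (hd : 0 < d₀ + d₁)
    (W : Submodule K ((Fin d₀ → ℂ) × (Fin d₁ → ℂ)))
    (hW : ∀ w ∈ W, (∀ i, w.1 i ∈ K) ∧ (∀ j, w.2 j ∈ K))
    (Y : Submodule ℤ ((Fin d₀ → ℂ) × (Fin d₁ → ℂ))) (hYfg : Y.FG)
    (hY : ∀ y ∈ Y, (∀ i, y.1 i ∈ K) ∧ (∀ j, cexp (y.2 j) ∈ K))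
    (Ya : Submodule ℤ ((Fin d₀ → ℂ) × (Fin d₁ → ℂ))) (hYa : Ya ≤ Y)
    (hYaL : ∀ y ∈ Ya, ∀ j, IsAlgebraic ℚ (cexp (y.2 j)))
    (hn : 2 * Module.finrank ℂ (span ℂ ((W : Set ((Fin d₀ → ℂ) × (Fin d₁ → ℂ))) ∪ (Y : Set _))) < d₀ + d₁)
    (hirr : ∀ (T₀ : Submodule ℂ (Fin d₀ → ℂ)) (T₁ : Submodule ℂ (Fin d₁ → ℂ)),
        IsKRational K T₀ → (∃ s : Set (Fin d₁ → ℚ), T₁ = ratSpan s) →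
        (∀ w ∈ W, w.1 ∈ T₀ ∧ w.2 ∈ T₁) → (∀ y ∈ Y, y.1 ∈ T₀ ∧ y.2 ∈ T₁) → T₀ = ⊤ ∧ T₁ = ⊤) :
    ∃ (d₀' d₁' : ℕ) (g : ((Fin d₀ → ℂ) × (Fin d₁ → ℂ)) →ₗ[ℂ] ((Fin d₀' → ℂ) × (Fin d₁' → ℂ))),
      0 < d₀' + d₁' ∧ Function.Surjective g ∧
      g '' {p | (∀ i, p.1 i ∈ K) ∧ p.2 = 0} = {q | (∀ i, q.1 i ∈ K) ∧ q.2 = 0} ∧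
      g '' {p | p.1 = 0 ∧ ∀ j, p.2 j ∈ Set.range ((↑) : ℚ → ℂ)} =
        {q | q.1 = 0 ∧ ∀ j, q.2 j ∈ Set.range ((↑) : ℚ → ℂ)} ∧
      2 * Module.finrank ℂ (span ℂ ((W.map (g.restrictScalars K) : Set ((Fin d₀' → ℂ) × (Fin d₁' → ℂ))) ∪
            (Y.map (g.restrictScalars ℤ) : Set _))) < d₀' + d₁' ∧
      Module.finrank K ↥(W.map (g.restrictScalars K)) <
        2 * Module.finrank ℂ (span ℂ ((W.map (g.restrictScalars K) : Set ((Fin d₀' → ℂ) × (Fin d₁' → ℂ))) ∪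
            (Y.map (g.restrictScalars ℤ) : Set _))) ∧
      d₁' * (d₀ + d₁ - 2 * Module.finrank ℂ (span ℂ ((W : Set ((Fin d₀ → ℂ) × (Fin d₁ → ℂ))) ∪ (Y : Set _)))) ≤
        d₁ * (d₀' + d₁' - 2 * Module.finrank ℂ (span ℂ ((W.map (g.restrictScalars K) :
            Set ((Fin d₀' → ℂ) × (Fin d₁' → ℂ))) ∪ (Y.map (g.restrictScalars ℤ) : Set _)))) ∧
      Module.finrank ℤ ↥(Y.map (g.restrictScalars ℤ)) *
          (d₀' + d₁' - 2 * Module.finrank ℂ (span ℂ ((W.map (g.restrictScalars K) :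
            Set ((Fin d₀' → ℂ) × (Fin d₁' → ℂ))) ∪ (Y.map (g.restrictScalars ℤ) : Set _)))) ≤
        d₁' * (2 * Module.finrank ℂ (span ℂ ((W.map (g.restrictScalars K) :
            Set ((Fin d₀' → ℂ) × (Fin d₁' → ℂ))) ∪ (Y.map (g.restrictScalars ℤ) : Set _))) -
          Module.finrank K ↥(W.map (g.restrictScalars K))) ∧
      ((d₀' < Module.finrank ℂ (span ℂ ((W.map (g.restrictScalars K) :
            Set ((Fin d₀' → ℂ) × (Fin d₁' → ℂ))) ∪ (Y.map (g.restrictScalars ℤ) : Set _))) ∨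
        Module.finrank K ↥(W.map (g.restrictScalars K)) <
          Module.finrank ℂ (span ℂ ((W.map (g.restrictScalars K) :
            Set ((Fin d₀' → ℂ) × (Fin d₁' → ℂ))) ∪ (Y.map (g.restrictScalars ℤ) : Set _))) ∨
        0 < Module.finrank ℤ ↥(Ya.map (g.restrictScalars ℤ))) →
        Module.finrank ℤ ↥(Y.map (g.restrictScalars ℤ)) *
            (d₀' + d₁' - 2 * Module.finrank ℂ (span ℂ ((W.map (g.restrictScalars K) :
              Set ((Fin d₀' → ℂ) × (Fin d₁' → ℂ))) ∪ (Y.map (g.restrictScalars ℤ) : Set _)))) <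
          d₁' * (2 * Module.finrank ℂ (span ℂ ((W.map (g.restrictScalars K) :
              Set ((Fin d₀' → ℂ) × (Fin d₁' → ℂ))) ∪ (Y.map (g.restrictScalars ℤ) : Set _))) -
            Module.finrank K ↥(W.map (g.restrictScalars K)))) := by
  classical
  -- the `K`-points map and a `K`-basis of `W`
  set φ : ((Fin d₀ → K) × (Fin d₁ → K)) →ₗ[K] ((Fin d₀ → ℂ) × (Fin d₁ → ℂ)) :=
    LinearMap.prodMap (Pi.algebraMap (Fin d₀) K ℂ) (Pi.algebraMap (Fin d₁) K ℂ) with hφ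
  have hφap : ∀ c, φ c = (ofK K c.1, ofK K c.2) := fun c => rfl
  set W' : Submodule K ((Fin d₀ → K) × (Fin d₁ → K)) := W.comap φ with hW'
  haveI : Module.Finite K W' := Module.Finite.of_injective W'.subtype W'.injective_subtype
  haveI : Module.Free K W' := Module.Free.of_divisionRing K W'
  let bW := Module.finBasis K W'
  set r := Module.finrank K W' with hr
  set b : Fin r → (Fin d₀ → ℂ) × (Fin d₁ → ℂ) := fun k => φ (bW k) with hb
  have hbW : ∀ k, b k ∈ W := fun k => (bW k).2
  have hbK : ∀ k, (∀ i, (b k).1 i ∈ K) ∧ (∀ j, (b k).2 j ∈ K) := fun k =>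
    ⟨fun i => by rw [hb]; simp only [hφap]; exact SetLike.coe_mem _,
     fun j => by rw [hb]; simp only [hφap]; exact SetLike.coe_mem _⟩
  have hWeq : W = span K (Set.range b) := by
    refine le_antisymm (fun w hw => ?_) (span_le.mpr (by rintro _ ⟨k, rfl⟩; exact hbW k))
    obtain ⟨h1, h2⟩ := hW w hw
    obtain ⟨c₀, hc₀⟩ := exists_ofK_of_mem K h1
    obtain ⟨c₁, hc₁⟩ := exists_ofK_of_mem K h2
    have hwφ : φ (c₀, c₁) = w := by rw [hφap]; exact Prod.ext hc₀.symm hc₁.symm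
    have hmem : (c₀, c₁) ∈ W' := by show φ (c₀, c₁) ∈ W; rw [hwφ]; exact hw
    have hrepr := bW.sum_repr ⟨(c₀, c₁), hmem⟩
    have hw' : w = ∑ k, (bW.repr ⟨(c₀, c₁), hmem⟩ k) • b k := by
      rw [← hwφ]
      have := congrArg (fun x : W' => φ (x : (Fin d₀ → K) × (Fin d₁ → K))) hrepr
      simp only [Submodule.coe_sum, Submodule.coe_smul, map_sum, map_smul] at this
      exact this.symm
    rw [hw']
    exact Submodule.sum_mem _ fun k _ => Submodule.smul_mem _ _ (subset_span ⟨k, rfl⟩)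
  -- generators of `Y` and the subfield `K₁`
  obtain ⟨sY, hsY⟩ := hYfg
  have hsYmem : ∀ y ∈ sY, y ∈ Y := fun y hy => by rw [← hsY]; exact subset_span hy
  set S : Finset ℂ :=
    (Finset.univ.biUnion fun k : Fin r =>
      (Finset.univ.image fun i : Fin d₀ => (b k).1 i) ∪ (Finset.univ.image fun j : Fin d₁ => (b k).2 j)) ∪
    (sY.biUnion fun y => (Finset.univ.image fun i : Fin d₀ => y.1 i) ∪
      (Finset.univ.image fun j : Fin d₁ => cexp (y.2 j))) with hSdef
  have hS : ∀ x ∈ S, x ∈ K := by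
    intro x hx
    rw [hSdef, Finset.mem_union] at hx
    rcases hx with hx | hx
    · obtain ⟨k, -, hk⟩ := Finset.mem_biUnion.mp hx
      rcases Finset.mem_union.mp hk with hk | hk
      · obtain ⟨i, -, rfl⟩ := Finset.mem_image.mp hk; exact (hbK k).1 i
      · obtain ⟨j, -, rfl⟩ := Finset.mem_image.mp hk; exact (hbK k).2 j
    · obtain ⟨y, hy, hk⟩ := Finset.mem_biUnion.mp hx
      rcases Finset.mem_union.mp hk with hk | hk
      · obtain ⟨i, -, rfl⟩ := Finset.mem_image.mp hk; exact ((hY y (hsYmem y hy)).1 i)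
      · obtain ⟨j, -, rfl⟩ := Finset.mem_image.mp hk; exact ((hY y (hsYmem y hy)).2 j)
  obtain ⟨K₁, hle, hfg, htr, hSK₁⟩ := exists_fg_subfield hK S hS
  have hbK₁ : ∀ k, (∀ i, (b k).1 i ∈ K₁) ∧ (∀ j, (b k).2 j ∈ K₁) := fun k =>
    ⟨fun i => hSK₁ _ (by
      rw [hSdef]; refine Finset.mem_union_left _ (Finset.mem_biUnion.mpr ⟨k, Finset.mem_univ _, ?_⟩)
      exact Finset.mem_union_left _ (Finset.mem_image.mpr ⟨i, Finset.mem_univ _, rfl⟩)),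
     fun j => hSK₁ _ (by
      rw [hSdef]; refine Finset.mem_union_left _ (Finset.mem_biUnion.mpr ⟨k, Finset.mem_univ _, ?_⟩)
      exact Finset.mem_union_right _ (Finset.mem_image.mpr ⟨j, Finset.mem_univ _, rfl⟩))⟩
  have hsYK₁ : ∀ y ∈ sY, (∀ i, y.1 i ∈ K₁) ∧ (∀ j, cexp (y.2 j) ∈ K₁) := fun y hy =>
    ⟨fun i => hSK₁ _ (by
      rw [hSdef]; refine Finset.mem_union_right _ (Finset.mem_biUnion.mpr ⟨y, hy, ?_⟩)
      exact Finset.mem_union_left _ (Finset.mem_image.mpr ⟨i, Finset.mem_univ _, rfl⟩)),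
     fun j => hSK₁ _ (by
      rw [hSdef]; refine Finset.mem_union_right _ (Finset.mem_biUnion.mpr ⟨y, hy, ?_⟩)
      exact Finset.mem_union_right _ (Finset.mem_image.mpr ⟨j, Finset.mem_univ _, rfl⟩))⟩
  -- `W₁ = K₁ · b` and the hypotheses of Théorème 1.1 over `K₁`
  set W₁ : Submodule K₁ ((Fin d₀ → ℂ) × (Fin d₁ → ℂ)) := span K₁ (Set.range b) with hW₁def
  have hW₁ : ∀ w ∈ W₁, (∀ i, w.1 i ∈ K₁) ∧ (∀ j, w.2 j ∈ K₁) := by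
    intro w hw
    rw [hW₁def] at hw
    induction hw using Submodule.span_induction with
    | mem x hx => obtain ⟨k, rfl⟩ := hx; exact hbK₁ k
    | zero => exact ⟨fun _ => zero_mem _, fun _ => zero_mem _⟩
    | add x y _ _ hx hy => exact ⟨fun i => add_mem (hx.1 i) (hy.1 i), fun j => add_mem (hx.2 j) (hy.2 j)⟩
    | smul c x _ hx =>
      refine ⟨fun i => ?_, fun j => ?_⟩
      · show ((c : ℂ) • x).1 i ∈ K₁
        rw [Prod.smul_fst, Pi.smul_apply, smul_eq_mul]; exact mul_mem c.2 (hx.1 i)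
      · show ((c : ℂ) • x).2 j ∈ K₁
        rw [Prod.smul_snd, Pi.smul_apply, smul_eq_mul]; exact mul_mem c.2 (hx.2 j)
  have hW₁W : ∀ w ∈ W₁, w ∈ W := by
    intro w hw
    rw [hW₁def] at hw
    induction hw using Submodule.span_induction with
    | mem x hx => obtain ⟨k, rfl⟩ := hx; exact hbW k
    | zero => exact zero_mem _
    | add x y _ _ hx hy => exact add_mem hx hy
    | smul c x _ hx =>
      have : (c • x : (Fin d₀ → ℂ) × (Fin d₁ → ℂ)) = (⟨(c : ℂ), hle c.2⟩ : K) • x := rfl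
      rw [this]; exact Submodule.smul_mem _ _ hx
  have hY₁ : ∀ y ∈ Y, (∀ i, y.1 i ∈ K₁) ∧ (∀ j, cexp (y.2 j) ∈ K₁) := by
    intro y hy
    rw [← hsY] at hy
    induction hy using Submodule.span_induction with
    | mem x hx => exact hsYK₁ x hx
    | zero => exact ⟨fun _ => zero_mem _, fun _ => by simp⟩
    | add x y _ _ hx hy =>
      exact ⟨fun i => add_mem (hx.1 i) (hy.1 i), fun j => by
        rw [Prod.snd_add, Pi.add_apply, Complex.exp_add]; exact mul_mem (hx.2 j) (hy.2 j)⟩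
    | smul c x _ hx =>
      refine ⟨fun i => ?_, fun j => ?_⟩
      · rw [Prod.smul_fst, Pi.smul_apply, zsmul_eq_mul]; exact mul_mem (intCast_mem _ _) (hx.1 i)
      · rw [Prod.smul_snd, Pi.smul_apply, zsmul_eq_mul, Complex.exp_int_mul]; exact zpow_mem (hx.2 j) _
  have hspanW : span ℂ (W₁ : Set ((Fin d₀ → ℂ) × (Fin d₁ → ℂ))) = span ℂ (W : Set _) := by
    refine le_antisymm (span_mono fun w hw => hW₁W w hw) (span_le.mpr fun w hw => ?_)
    have hw' : w ∈ span K (Set.range b) := by rw [← hWeq]; exact hw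
    have hsub : span ℂ (Set.range b) ≤ span ℂ (W₁ : Set ((Fin d₀ → ℂ) × (Fin d₁ → ℂ))) :=
      span_mono (by rintro _ ⟨k, rfl⟩; exact subset_span ⟨k, rfl⟩)
    refine hsub ?_
    clear hw
    induction hw' using Submodule.span_induction with
    | mem x hx => exact subset_span hx
    | zero => exact zero_mem _
    | add x y _ _ hx hy => exact add_mem hx hy
    | smul c x _ hx =>
      have : (c • x : (Fin d₀ → ℂ) × (Fin d₁ → ℂ)) = (c : ℂ) • x := rfl
      rw [this]; exact Submodule.smul_mem _ _ hx
  have hspanWY : span ℂ ((W₁ : Set ((Fin d₀ → ℂ) × (Fin d₁ → ℂ))) ∪ (Y : Set _)) =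
      span ℂ ((W : Set ((Fin d₀ → ℂ) × (Fin d₁ → ℂ))) ∪ (Y : Set _)) := by
    rw [Submodule.span_union, Submodule.span_union, hspanW]
  have hn₁ : 2 * Module.finrank ℂ (span ℂ ((W₁ : Set ((Fin d₀ → ℂ) × (Fin d₁ → ℂ))) ∪ (Y : Set _))) < d₀ + d₁ := by
    rw [hspanWY]; exact hn
  have hirr₁ : ∀ (T₀ : Submodule ℂ (Fin d₀ → ℂ)) (T₁ : Submodule ℂ (Fin d₁ → ℂ)),
      IsKRational K₁ T₀ → (∃ s : Set (Fin d₁ → ℚ), T₁ = ratSpan s) →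
      (∀ w ∈ W₁, w.1 ∈ T₀ ∧ w.2 ∈ T₁) → (∀ y ∈ Y, y.1 ∈ T₀ ∧ y.2 ∈ T₁) → T₀ = ⊤ ∧ T₁ = ⊤ := by
    intro T₀ T₁ hT₀ hT₁ hW₁T hYT
    refine hirr T₀ T₁ ?_ hT₁ (fun w hw => ?_) hYT
    · obtain ⟨s₀, hs₀⟩ := hT₀
      refine ⟨(fun c => fun i => (⟨(c i : ℂ), hle (c i).2⟩ : K)) '' s₀, ?_⟩
      rw [hs₀]; congr 1
      ext v; simp only [Set.mem_image]
      constructor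
      · rintro ⟨c, hc, rfl⟩; exact ⟨_, ⟨c, hc, rfl⟩, rfl⟩
      · rintro ⟨_, ⟨c, hc, rfl⟩, rfl⟩; exact ⟨c, hc, rfl⟩
    · have hw' : w ∈ span ℂ (W₁ : Set ((Fin d₀ → ℂ) × (Fin d₁ → ℂ))) := by rw [hspanW]; exact subset_span hw
      have hle' : span ℂ (W₁ : Set ((Fin d₀ → ℂ) × (Fin d₁ → ℂ))) ≤ T₀.prod T₁ :=
        span_le.mpr fun v hv => hW₁T v hv
      exact hle' hw'
  -- Théorème 1.1 over `K₁`
  obtain ⟨d₀', d₁', g, hd', hsurj, himK₁, himQ, hrest⟩ :=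
    thm_1_1_of_h51 (h51all K₁ hfg htr) d₀ d₁ hd W₁ hW₁ Y ⟨sY, hsY⟩ hY₁ Ya hYa hYaL hn₁ hirr₁
  -- comparison of the primed quantities over `K₁` and over `K`
  have en : span ℂ ((W₁.map (g.restrictScalars K₁) : Set ((Fin d₀' → ℂ) × (Fin d₁' → ℂ))) ∪
        (Y.map (g.restrictScalars ℤ) : Set _)) =
      span ℂ ((W.map (g.restrictScalars K) : Set ((Fin d₀' → ℂ) × (Fin d₁' → ℂ))) ∪
        (Y.map (g.restrictScalars ℤ) : Set _)) := by
    simp only [Submodule.span_union, Submodule.map_coe, LinearMap.coe_restrictScalars, Submodule.span_image,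
      hspanW]
  have hgb : ∀ k, (∀ i, ((g ∘ b) k).1 i ∈ K₁) ∧ (∀ j, ((g ∘ b) k).2 j ∈ K₁) := fun k =>
    coords_of_images K₁ g himK₁.le himQ.le (b k) (hbK₁ k)
  have eℓ₀ : Module.finrank K₁ ↥(W₁.map (g.restrictScalars K₁)) = Module.finrank K ↥(W.map (g.restrictScalars K)) := by
    have h1 : W₁.map (g.restrictScalars K₁) = span K₁ (Set.range (g ∘ b)) := by
      rw [hW₁def, Submodule.map_span, Set.range_comp]; rfl
    have h2 : W.map (g.restrictScalars K) = span K (Set.range (g ∘ b)) := by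
      rw [hWeq, Submodule.map_span, Set.range_comp]; rfl
    rw [h1, h2, finrank_span_eq_of_coords K₁ (g ∘ b) hgb,
      finrank_span_eq_of_coords K (g ∘ b) (fun k => ⟨fun i => hle ((hgb k).1 i), fun j => hle ((hgb k).2 j)⟩)]
  refine ⟨d₀', d₁', g, hd', hsurj, image_kset_of_le hle g himK₁, himQ, ?_⟩
  rw [← en, ← eℓ₀, ← hspanWY]
  exact hrest

/-! ### Corollaire 1.3 from Théorème 1.1 at transcendence degree `1` -/

set_option maxHeartbeats 800000 in
/-- **Case (b) of the proof of Corollaire 1.3** (pp. 758–759; the proof of `cor_1_3_case_b` of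
`…Thm11.lean` with Théorème 1.1 assumed only at transcendence degree `1`, which is all it uses): if no smaller `d₁'` works, Théorème
1.1 applied to `d₀ = n`, `W = graph(φ|Kⁿ)`, `Y = {(x, φx) ; φx ∈ X}`, `Y_a = Y ∩ (Kⁿ × 𝓛^{d₁})`
yields the conclusion of Corollaire 1.3 with `g₁ = id`.
[cite: RoyWaldschmidt1997ENS, proof of Corollaire 1.3 (b), pp. 758–759] -/
theorem cor_1_3_case_b_eq
    (h11 : ∀ (K : IntermediateField ℚ ℂ), Algebra.trdeg ℚ K = 1 →
      ∀ (d₀ d₁ : ℕ), 0 < d₀ + d₁ →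
      ∀ (W : Submodule K ((Fin d₀ → ℂ) × (Fin d₁ → ℂ))),
        (∀ w ∈ W, (∀ i, w.1 i ∈ K) ∧ (∀ j, w.2 j ∈ K)) →
      ∀ (Y : Submodule ℤ ((Fin d₀ → ℂ) × (Fin d₁ → ℂ))), Y.FG →
        (∀ y ∈ Y, (∀ i, y.1 i ∈ K) ∧ (∀ j, cexp (y.2 j) ∈ K)) →
      ∀ (Ya : Submodule ℤ ((Fin d₀ → ℂ) × (Fin d₁ → ℂ))), Ya ≤ Y →
        (∀ y ∈ Ya, ∀ j, IsAlgebraic ℚ (cexp (y.2 j))) →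
      2 * Module.finrank ℂ (span ℂ ((W : Set ((Fin d₀ → ℂ) × (Fin d₁ → ℂ))) ∪ (Y : Set _))) < d₀ + d₁ →
      (∀ (T₀ : Submodule ℂ (Fin d₀ → ℂ)) (T₁ : Submodule ℂ (Fin d₁ → ℂ)),
          IsKRational K T₀ → (∃ s : Set (Fin d₁ → ℚ), T₁ = ratSpan s) →
          (∀ w ∈ W, w.1 ∈ T₀ ∧ w.2 ∈ T₁) → (∀ y ∈ Y, y.1 ∈ T₀ ∧ y.2 ∈ T₁) → T₀ = ⊤ ∧ T₁ = ⊤) →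
      ∃ (d₀' d₁' : ℕ) (g : ((Fin d₀ → ℂ) × (Fin d₁ → ℂ)) →ₗ[ℂ] ((Fin d₀' → ℂ) × (Fin d₁' → ℂ))),
        0 < d₀' + d₁' ∧ Function.Surjective g ∧
        g '' {p | (∀ i, p.1 i ∈ K) ∧ p.2 = 0} = {q | (∀ i, q.1 i ∈ K) ∧ q.2 = 0} ∧
        g '' {p | p.1 = 0 ∧ ∀ j, p.2 j ∈ Set.range ((↑) : ℚ → ℂ)} =
          {q | q.1 = 0 ∧ ∀ j, q.2 j ∈ Set.range ((↑) : ℚ → ℂ)} ∧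
        2 * Module.finrank ℂ (span ℂ ((W.map (g.restrictScalars K) : Set ((Fin d₀' → ℂ) × (Fin d₁' → ℂ))) ∪
              (Y.map (g.restrictScalars ℤ) : Set _))) < d₀' + d₁' ∧
        Module.finrank K ↥(W.map (g.restrictScalars K)) <
          2 * Module.finrank ℂ (span ℂ ((W.map (g.restrictScalars K) : Set ((Fin d₀' → ℂ) × (Fin d₁' → ℂ))) ∪
              (Y.map (g.restrictScalars ℤ) : Set _))) ∧
        d₁' * (d₀ + d₁ - 2 * Module.finrank ℂ (span ℂ ((W : Set ((Fin d₀ → ℂ) × (Fin d₁ → ℂ))) ∪ (Y : Set _)))) ≤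
          d₁ * (d₀' + d₁' - 2 * Module.finrank ℂ (span ℂ ((W.map (g.restrictScalars K) :
              Set ((Fin d₀' → ℂ) × (Fin d₁' → ℂ))) ∪ (Y.map (g.restrictScalars ℤ) : Set _)))) ∧
        Module.finrank ℤ ↥(Y.map (g.restrictScalars ℤ)) *
            (d₀' + d₁' - 2 * Module.finrank ℂ (span ℂ ((W.map (g.restrictScalars K) :
              Set ((Fin d₀' → ℂ) × (Fin d₁' → ℂ))) ∪ (Y.map (g.restrictScalars ℤ) : Set _)))) ≤
          d₁' * (2 * Module.finrank ℂ (span ℂ ((W.map (g.restrictScalars K) :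
              Set ((Fin d₀' → ℂ) × (Fin d₁' → ℂ))) ∪ (Y.map (g.restrictScalars ℤ) : Set _))) -
            Module.finrank K ↥(W.map (g.restrictScalars K))) ∧
        ((d₀' < Module.finrank ℂ (span ℂ ((W.map (g.restrictScalars K) :
              Set ((Fin d₀' → ℂ) × (Fin d₁' → ℂ))) ∪ (Y.map (g.restrictScalars ℤ) : Set _))) ∨
          Module.finrank K ↥(W.map (g.restrictScalars K)) <
            Module.finrank ℂ (span ℂ ((W.map (g.restrictScalars K) :
              Set ((Fin d₀' → ℂ) × (Fin d₁' → ℂ))) ∪ (Y.map (g.restrictScalars ℤ) : Set _))) ∨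
          0 < Module.finrank ℤ ↥(Ya.map (g.restrictScalars ℤ))) →
          Module.finrank ℤ ↥(Y.map (g.restrictScalars ℤ)) *
              (d₀' + d₁' - 2 * Module.finrank ℂ (span ℂ ((W.map (g.restrictScalars K) :
                Set ((Fin d₀' → ℂ) × (Fin d₁' → ℂ))) ∪ (Y.map (g.restrictScalars ℤ) : Set _)))) <
            d₁' * (2 * Module.finrank ℂ (span ℂ ((W.map (g.restrictScalars K) :
                Set ((Fin d₀' → ℂ) × (Fin d₁' → ℂ))) ∪ (Y.map (g.restrictScalars ℤ) : Set _))) -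
              Module.finrank K ↥(W.map (g.restrictScalars K)))))
    (K : IntermediateField ℚ ℂ) (hK : Algebra.trdeg ℚ K = 1) (d₁ : ℕ) (hd₁ : 0 < d₁)
    (X : Submodule ℤ (Fin d₁ → ℂ)) (hX : X.FG) (hXK : ∀ x ∈ X, ∀ i, x i ∈ K ∧ cexp (x i) ∈ K)
    (hn : Module.finrank ℂ (span ℂ (X : Set (Fin d₁ → ℂ))) < d₁)
    (hirr : ∀ s : Set (Fin d₁ → ℚ), X ≤ (ratSpan s).restrictScalars ℤ → ratSpan s = ⊤)
    (hnot : ¬ ∃ d₁' : ℕ, d₁' < d₁ ∧ ∃ (g : (Fin d₁ → ℂ) →ₗ[ℂ] (Fin d₁' → ℂ))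
      (g₀ : (Fin d₁ → ℚ) →ₗ[ℚ] (Fin d₁' → ℚ)), Function.Surjective g ∧
      (∀ v : Fin d₁ → ℚ, g (fun j => ((v j : ℚ) : ℂ)) = fun i => ((g₀ v i : ℚ) : ℂ)) ∧
      Module.finrank ℂ (span ℂ (X.map (g.restrictScalars ℤ) : Set (Fin d₁' → ℂ))) < d₁' ∧
      d₁ * Module.finrank ℂ (span ℂ (X.map (g.restrictScalars ℤ) : Set (Fin d₁' → ℂ))) ≤
        d₁' * Module.finrank ℂ (span ℂ (X : Set (Fin d₁ → ℂ)))) :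
    0 < Module.finrank ℂ (span ℂ (X : Set (Fin d₁ → ℂ))) ∧
    Module.finrank ℤ ↥X * d₁ ≤
      Module.finrank ℂ (span ℂ (X : Set (Fin d₁ → ℂ))) * (d₁ + Module.finrank ℤ ↥X) ∧
    ((∃ x ∈ X, x ≠ 0 ∧ ∀ i, IsAlgebraic ℚ (cexp (x i))) →
      Module.finrank ℤ ↥X * d₁ <
        Module.finrank ℂ (span ℂ (X : Set (Fin d₁ → ℂ))) * (d₁ + Module.finrank ℤ ↥X)) := by
  classical
  -- (B1) a basis `x` of `ℂX` inside `X`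
  obtain ⟨n, x, hxX, hxli, hxspan, hfr⟩ := exists_basis_mem X
  rw [hfr] at hn hnot ⊢
  haveI : Nonempty (Fin d₁) := ⟨⟨0, hd₁⟩⟩
  -- `n > 0`
  have hn0 : 0 < n := by
    by_contra h0
    push Not at h0
    have hn' : n = 0 := Nat.le_zero.mp h0
    subst hn'
    have hbot : span ℂ (X : Set (Fin d₁ → ℂ)) = ⊥ := by
      rw [← hxspan, Set.range_eq_empty, Submodule.span_empty]
    have hXle : X ≤ (ratSpan (∅ : Set (Fin d₁ → ℚ))).restrictScalars ℤ := by
      intro ξ hξ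
      have : ξ ∈ span ℂ (X : Set (Fin d₁ → ℂ)) := subset_span hξ
      rw [hbot, Submodule.mem_bot] at this
      rw [this]; exact Submodule.zero_mem _
    have := hirr ∅ hXle
    rw [ratSpan_empty] at this
    exact bot_ne_top this
  -- (B2) `K`-versions of the `x i`, the map `φ` and its `K`-form
  have hxK : ∀ i j, x i j ∈ K := fun i j => (hXK _ (hxX i) j).1
  set xK : Fin n → Fin d₁ → K := fun i j => ⟨x i j, hxK i j⟩ with hxKdef
  have hxK_eq : ∀ i, ofK K (L := ℂ) (xK i) = x i := fun i => funext fun j => rfl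
  set φ : (Fin n → ℂ) →ₗ[ℂ] (Fin d₁ → ℂ) := Fintype.linearCombination ℂ x with hφ
  have hφ_apply : ∀ c, φ c = ∑ i, c i • x i := fun c => Fintype.linearCombination_apply ℂ x c
  have hφinj : Function.Injective φ := hxli.fintypeLinearCombination_injective
  have hφrange : LinearMap.range φ = span ℂ (X : Set (Fin d₁ → ℂ)) := by
    rw [hφ, Fintype.range_linearCombination, hxspan]
  set φK : (Fin n → K) →ₗ[K] (Fin d₁ → K) := Fintype.linearCombination K xK with hφK
  have hφ_ofK : ∀ c : Fin n → K, φ (ofK K c) = ofK K (φK c) := by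
    intro c
    rw [hφ_apply, hφK, Fintype.linearCombination_apply]
    funext j
    simp only [Finset.sum_apply, Pi.smul_apply, smul_eq_mul, ofK_apply, map_sum, map_mul]
    refine Finset.sum_congr rfl fun i _ => ?_
    rw [← hxK_eq i, ofK_apply]
  -- `X ⊆ φ(Kⁿ)` (span descent)
  have hXφ : ∀ ξ ∈ X, ∃ c : Fin n → K, φ (ofK K c) = ξ := by
    intro ξ hξ
    have hξK : ∀ j, ξ j ∈ K := fun j => (hXK ξ hξ j).1
    set ξK : Fin d₁ → K := fun j => ⟨ξ j, hξK j⟩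
    have hξeq : ofK K (L := ℂ) ξK = ξ := funext fun j => rfl
    have h1 : ξK ∈ kPoints K (span ℂ (ofK K (L := ℂ) '' Set.range xK)) := by
      rw [mem_kPoints, hξeq]
      have : ofK K (L := ℂ) '' Set.range xK = Set.range x := by
        ext v; constructor
        · rintro ⟨_, ⟨i, rfl⟩, rfl⟩; exact ⟨i, (hxK_eq i).symm⟩
        · rintro ⟨i, rfl⟩; exact ⟨xK i, ⟨i, rfl⟩, hxK_eq i⟩
      rw [this, hxspan]; exact subset_span hξ
    rw [kPoints_span_ofK] at h1
    obtain ⟨c, hc⟩ := (Submodule.mem_span_range_iff_exists_fun K).mp h1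
    refine ⟨c, ?_⟩
    rw [hφ_ofK, ← hξeq, ← hc, hφK, Fintype.linearCombination_apply]
  -- (B3) the `K`-linear map `ψ : c ↦ (c, φ c)` and `W = ψ(Kⁿ)`
  set ι : (Fin n → K) →ₗ[K] (Fin n → ℂ) :=
    { toFun := ofK K, map_add' := fun v w => by funext j; simp,
      map_smul' := fun c v => by funext j; simp [Algebra.smul_def] } with hι
  have hι_apply : ∀ c, ι c = ofK K c := fun c => rfl
  set ψ : (Fin n → K) →ₗ[K] ((Fin n → ℂ) × (Fin d₁ → ℂ)) :=
    LinearMap.prod ι ((φ.restrictScalars K).comp ι) with hψ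
  have hψ_apply : ∀ c, ψ c = (ofK K c, φ (ofK K c)) := fun c => rfl
  have hψinj : Function.Injective ψ := by
    intro c c' h
    have := congrArg Prod.fst h
    rw [hψ_apply, hψ_apply] at this
    exact ofK_injective K this
  set W : Submodule K ((Fin n → ℂ) × (Fin d₁ → ℂ)) := LinearMap.range ψ with hW
  have hmemW : ∀ p, p ∈ W ↔ ∃ c, (ofK K c, φ (ofK K c)) = p := fun p => by
    rw [hW, LinearMap.mem_range]
    simp only [hψ_apply]
  -- `Y = {(x, φ x) ∈ W ; φ x ∈ X}` and `Y_a = Y ∩ (Kⁿ × 𝓛^{d₁})`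
  obtain ⟨A, hA⟩ := exists_submodule_isAlgebraic_cexp d₁
  set sndZ : ((Fin n → ℂ) × (Fin d₁ → ℂ)) →ₗ[ℤ] (Fin d₁ → ℂ) := (LinearMap.snd ℂ _ _).restrictScalars ℤ
    with hsndZ
  set Y : Submodule ℤ ((Fin n → ℂ) × (Fin d₁ → ℂ)) := W.restrictScalars ℤ ⊓ X.comap sndZ with hY
  set Ya : Submodule ℤ ((Fin n → ℂ) × (Fin d₁ → ℂ)) := Y ⊓ A.comap sndZ with hYa
  have hmemY : ∀ p, p ∈ Y ↔ p ∈ W ∧ p.2 ∈ X := fun p => by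
    rw [hY, Submodule.mem_inf, Submodule.restrictScalars_mem, Submodule.mem_comap]; rfl
  have hmemYa : ∀ p, p ∈ Ya ↔ p ∈ Y ∧ ∀ j, IsAlgebraic ℚ (cexp (p.2 j)) := fun p => by
    rw [hYa, Submodule.mem_inf, Submodule.mem_comap, hA]; rfl
  -- every `ξ ∈ X` lifts to `Y`
  have hlift : ∀ ξ ∈ X, ∃ c : Fin n → K, (ofK K c, ξ) ∈ Y ∧ φ (ofK K c) = ξ := by
    intro ξ hξ
    obtain ⟨c, hc⟩ := hXφ ξ hξ
    refine ⟨c, (hmemY _).mpr ⟨(hmemW _).mpr ⟨c, by rw [hc]⟩, hξ⟩, hc⟩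
  -- (B4) hypotheses of Théorème 1.1
  have hWK : ∀ w ∈ W, (∀ i, w.1 i ∈ K) ∧ (∀ j, w.2 j ∈ K) := by
    intro w hw
    obtain ⟨c, rfl⟩ := (hmemW w).mp hw
    refine ⟨fun i => by simp [ofK_apply], fun j => ?_⟩
    show φ (ofK K c) j ∈ K
    rw [hφ_ofK]; simp [ofK_apply]
  have hYK : ∀ y ∈ Y, (∀ i, y.1 i ∈ K) ∧ (∀ j, cexp (y.2 j) ∈ K) := by
    intro y hy
    obtain ⟨hyW, hyX⟩ := (hmemY y).mp hy
    exact ⟨(hWK y hyW).1, fun j => (hXK _ hyX j).2⟩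
  have hYaY : Ya ≤ Y := inf_le_left
  have hYaalg : ∀ y ∈ Ya, ∀ j, IsAlgebraic ℚ (cexp (y.2 j)) := fun y hy => ((hmemYa y).mp hy).2
  -- `snd` is injective on `W`, so `Y ≅ X` and `Y` is finitely generated
  have hsnd_inj : ∀ p ∈ W, ∀ q ∈ W, p.2 = q.2 → p = q := by
    intro p hp q hq h
    obtain ⟨c, rfl⟩ := (hmemW p).mp hp
    obtain ⟨c', rfl⟩ := (hmemW q).mp hq
    simp only at h
    have : ofK K (L := ℂ) c = ofK K c' := hφinj h
    rw [this]
  haveI hXfin : Module.Finite ℤ X := Module.Finite.iff_fg.mpr hX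
  have hYmap : Y.map sndZ = X := by
    refine le_antisymm ?_ ?_
    · rintro _ ⟨p, hp, rfl⟩; exact ((hmemY p).mp hp).2
    · intro ξ hξ
      obtain ⟨c, hc, -⟩ := hlift ξ hξ
      exact ⟨_, hc, rfl⟩
  have hYinj : Set.InjOn sndZ Y := fun p hp q hq h =>
    hsnd_inj p ((hmemY p).mp hp).1 q ((hmemY q).mp hq).1 h
  -- the restriction of `snd` to `Y` as an injective map onto `X`
  set θ : Y →ₗ[ℤ] (Fin d₁ → ℂ) := sndZ.comp Y.subtype with hθ
  have hθinj : Function.Injective θ := by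
    intro p q h
    exact Subtype.ext (hYinj p.2 q.2 h)
  have hθrange : LinearMap.range θ = X := by
    rw [hθ, LinearMap.range_comp, Submodule.range_subtype, hYmap]
  have hYX : Y ≃ₗ[ℤ] X :=
    (LinearEquiv.ofInjective θ hθinj).trans (LinearEquiv.ofEq _ _ hθrange)
  haveI : Module.Finite ℤ Y := Module.Finite.equiv hYX.symm
  have hYfg : Y.FG := Module.Finite.iff_fg.mp inferInstance
  -- `span_ℂ (W ∪ Y) = range of c ↦ (c, φ c)`, of dimension `n`
  set Ψ : (Fin n → ℂ) →ₗ[ℂ] ((Fin n → ℂ) × (Fin d₁ → ℂ)) := LinearMap.prod LinearMap.id φ with hΨ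
  have hΨinj : Function.Injective Ψ := fun c c' h => congrArg Prod.fst h
  have hspanWY : span ℂ ((W : Set ((Fin n → ℂ) × (Fin d₁ → ℂ))) ∪ (Y : Set _)) = LinearMap.range Ψ := by
    refine le_antisymm (span_le.mpr ?_) ?_
    · rintro p (hp | hp)
      · obtain ⟨c, rfl⟩ := (hmemW p).mp hp; exact ⟨ofK K c, rfl⟩
      · obtain ⟨c, rfl⟩ := (hmemW p).mp ((hmemY p).mp hp).1; exact ⟨ofK K c, rfl⟩
    · rintro _ ⟨c, rfl⟩
      have hc : c ∈ (⊤ : Submodule ℂ (Fin n → ℂ)) := trivial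
      rw [← eq_top_of_forall_ofK_mem K (T := (span ℂ ((W : Set ((Fin n → ℂ) × (Fin d₁ → ℂ))) ∪
        (Y : Set _))).comap Ψ) (fun c' => ?_)] at hc
      · exact hc
      · exact subset_span (Or.inl ((hmemW _).mpr ⟨c', rfl⟩))
  have hnWY : Module.finrank ℂ (span ℂ ((W : Set ((Fin n → ℂ) × (Fin d₁ → ℂ))) ∪ (Y : Set _))) = n := by
    rw [hspanWY, LinearMap.finrank_range_of_inj hΨinj, Module.finrank_fin_fun]
  -- irreducibility
  have hirr' : ∀ (T₀ : Submodule ℂ (Fin n → ℂ)) (T₁ : Submodule ℂ (Fin d₁ → ℂ)),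
      IsKRational K T₀ → (∃ s : Set (Fin d₁ → ℚ), T₁ = ratSpan s) →
      (∀ w ∈ W, w.1 ∈ T₀ ∧ w.2 ∈ T₁) → (∀ y ∈ Y, y.1 ∈ T₀ ∧ y.2 ∈ T₁) → T₀ = ⊤ ∧ T₁ = ⊤ := by
    intro T₀ T₁ _ ⟨s, hs⟩ hWT _
    refine ⟨eq_top_of_forall_ofK_mem K fun c => (hWT _ ((hmemW _).mpr ⟨c, rfl⟩)).1, ?_⟩
    rw [hs]
    refine hirr s fun ξ hξ => ?_
    obtain ⟨c, hc⟩ := hXφ ξ hξ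
    have := (hWT _ ((hmemW _).mpr ⟨c, rfl⟩)).2
    rw [hs] at this
    simpa [hc] using this
  -- (B5) apply Théorème 1.1 with `d₀ = n`
  have hlt : 2 * Module.finrank ℂ (span ℂ ((W : Set ((Fin n → ℂ) × (Fin d₁ → ℂ))) ∪ (Y : Set _))) < n + d₁ := by
    rw [hnWY]; omega
  obtain ⟨d₀', d₁', g, hdpos, hgsurj, hgK, hgQ, h2n', hℓ₀', hineq1, hineq2, hstrict⟩ :=
    h11 K hK n d₁ (by omega) W hWK Y hYfg hYK Ya hYaY hYaalg hlt hirr'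
  rw [hnWY] at hineq1
  -- abbreviations
  set W' := W.map (g.restrictScalars K) with hW'
  set Y' := Y.map (g.restrictScalars ℤ) with hY'
  set Ya' := Ya.map (g.restrictScalars ℤ) with hYa'
  set n' := Module.finrank ℂ (span ℂ ((W' : Set ((Fin d₀' → ℂ) × (Fin d₁' → ℂ))) ∪ (Y' : Set _))) with hn'
  set ℓ₀' := Module.finrank K ↥W' with hℓ₀'def
  set ℓ₁' := Module.finrank ℤ ↥Y' with hℓ₁'def
  set ℓa' := Module.finrank ℤ ↥Ya' with hℓa'def
  -- (B6) block structure of `g`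
  have hg2 : ∀ u : Fin n → ℂ, (g (u, 0)).2 = 0 := by
    intro u
    have key : ∀ c : Fin n → K, (g (ofK K c, 0)).2 = 0 := by
      intro c
      have : g (ofK K c, 0) ∈ g '' {p | (∀ i, p.1 i ∈ K) ∧ p.2 = 0} :=
        ⟨(ofK K c, 0), ⟨fun i => by simp [ofK_apply], rfl⟩, rfl⟩
      rw [hgK] at this
      exact this.2
    have htop := eq_top_of_forall_ofK_mem K
      (T := LinearMap.ker ((LinearMap.snd ℂ _ _).comp (g.comp (LinearMap.inl ℂ _ _)))) fun c => key c
    have : u ∈ LinearMap.ker ((LinearMap.snd ℂ _ _).comp (g.comp (LinearMap.inl ℂ _ _))) := by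
      rw [htop]; trivial
    exact this
  have hg1 : ∀ v : Fin d₁ → ℂ, (g (0, v)).1 = 0 := by
    intro v
    have key : ∀ q : Fin d₁ → ℚ, (g (0, fun j => ((q j : ℚ) : ℂ))).1 = 0 := by
      intro q
      have : g (0, fun j => ((q j : ℚ) : ℂ)) ∈ g '' {p | p.1 = 0 ∧ ∀ j, p.2 j ∈ Set.range ((↑) : ℚ → ℂ)} :=
        ⟨(0, fun j => ((q j : ℚ) : ℂ)), ⟨rfl, fun j => ⟨q j, rfl⟩⟩, rfl⟩
      rw [hgQ] at this
      exact this.1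
    have htop := eq_top_of_forall_rat_mem
      (T := LinearMap.ker ((LinearMap.fst ℂ _ _).comp (g.comp (LinearMap.inr ℂ _ _)))) fun q => key q
    have : v ∈ LinearMap.ker ((LinearMap.fst ℂ _ _).comp (g.comp (LinearMap.inr ℂ _ _))) := by
      rw [htop]; trivial
    exact this
  set g₀ : (Fin n → ℂ) →ₗ[ℂ] (Fin d₀' → ℂ) := (LinearMap.fst ℂ _ _).comp (g.comp (LinearMap.inl ℂ _ _)) with hg₀
  set g₁ : (Fin d₁ → ℂ) →ₗ[ℂ] (Fin d₁' → ℂ) := (LinearMap.snd ℂ _ _).comp (g.comp (LinearMap.inr ℂ _ _)) with hg₁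
  have hg_apply : ∀ p, g p = (g₀ p.1, g₁ p.2) := by
    rintro ⟨u, v⟩
    have : g (u, v) = g (u, 0) + g (0, v) := by rw [← map_add]; simp
    rw [this]
    ext1
    · simp only [Prod.fst_add, hg1 v, add_zero]; rfl
    · simp only [Prod.snd_add, hg2 u, zero_add]; rfl
  -- `g₁` is defined over `ℚ` and surjective; `g₀` is surjective
  have hg₁rat : ∀ q : Fin d₁ → ℚ, ∃ w : Fin d₁' → ℚ, g₁ (fun j => ((q j : ℚ) : ℂ)) = fun i => ((w i : ℚ) : ℂ) := by
    intro q
    have : g (0, fun j => ((q j : ℚ) : ℂ)) ∈ g '' {p | p.1 = 0 ∧ ∀ j, p.2 j ∈ Set.range ((↑) : ℚ → ℂ)} :=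
      ⟨(0, fun j => ((q j : ℚ) : ℂ)), ⟨rfl, fun j => ⟨q j, rfl⟩⟩, rfl⟩
    rw [hgQ] at this
    obtain ⟨-, h2⟩ := this
    choose w hw using h2
    exact ⟨w, funext fun i => (hw i).symm⟩
  obtain ⟨g₁₀, hg₁₀⟩ := exists_ratStructure g₁ hg₁rat
  have hg₁surj : Function.Surjective g₁ := by
    rw [← LinearMap.range_eq_top]
    refine eq_top_of_forall_rat_mem fun w => ?_
    have : ((0 : Fin d₀' → ℂ), fun i => ((w i : ℚ) : ℂ)) ∈ g '' {p | p.1 = 0 ∧ ∀ j, p.2 j ∈ Set.range ((↑) : ℚ → ℂ)} := by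
      rw [hgQ]; exact ⟨rfl, fun i => ⟨w i, rfl⟩⟩
    obtain ⟨p, ⟨hp1, -⟩, hp⟩ := this
    refine ⟨p.2, ?_⟩
    have := congrArg Prod.snd hp
    rw [hg_apply] at this
    simpa [hp1] using this
  have hg₀surj : Function.Surjective g₀ := by
    rw [← LinearMap.range_eq_top]
    refine eq_top_of_forall_ofK_mem K fun c' => ?_
    have : (ofK K (L := ℂ) c', (0 : Fin d₁' → ℂ)) ∈ g '' {p | (∀ i, p.1 i ∈ K) ∧ p.2 = 0} := by
      rw [hgK]; exact ⟨fun i => by simp [ofK_apply], rfl⟩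
    obtain ⟨p, ⟨-, hp2⟩, hp⟩ := this
    refine ⟨p.1, ?_⟩
    have := congrArg Prod.fst hp
    rw [hg_apply] at this
    simpa [hp2] using this
  -- dimension counts: `d₀' ≤ n`, `d₁' ≤ d₁`
  have hd₀'n : d₀' ≤ n := by
    have := LinearMap.finrank_range_le g₀
    rw [LinearMap.range_eq_top.mpr hg₀surj, finrank_top, Module.finrank_fin_fun, Module.finrank_fin_fun] at this
    exact this
  have hd₁'d₁ : d₁' ≤ d₁ := by
    have := LinearMap.finrank_range_le g₁
    rw [LinearMap.range_eq_top.mpr hg₁surj, finrank_top, Module.finrank_fin_fun, Module.finrank_fin_fun] at this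
    exact this
  -- `n' ≥ d₀'`: the first projection of `span W'` is everything
  have hspanW'le : span ℂ (W' : Set ((Fin d₀' → ℂ) × (Fin d₁' → ℂ))) ≤
      span ℂ ((W' : Set ((Fin d₀' → ℂ) × (Fin d₁' → ℂ))) ∪ (Y' : Set _)) := span_mono Set.subset_union_left
  have hn'd₀' : d₀' ≤ n' := by
    have h1 : (span ℂ (W' : Set ((Fin d₀' → ℂ) × (Fin d₁' → ℂ)))).map (LinearMap.fst ℂ _ _) = ⊤ := by
      refine eq_top_of_forall_ofK_mem K fun c' => ?_
      obtain ⟨u, hu⟩ := hg₀surj (ofK K c')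
      -- `u ∈ ℂⁿ = span of K-points`; use linearity through the comap
      have hmem : ∀ c : Fin n → K, g₀ (ofK K c) ∈
          (span ℂ (W' : Set ((Fin d₀' → ℂ) × (Fin d₁' → ℂ)))).map (LinearMap.fst ℂ _ _) := by
        intro c
        refine ⟨g (ofK K c, φ (ofK K c)), subset_span ⟨(ofK K c, φ (ofK K c)), (hmemW _).mpr ⟨c, rfl⟩, rfl⟩, ?_⟩
        rw [hg_apply]; rfl
      have htop := eq_top_of_forall_ofK_mem K
        (T := ((span ℂ (W' : Set ((Fin d₀' → ℂ) × (Fin d₁' → ℂ)))).map (LinearMap.fst ℂ _ _)).comap g₀) hmem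
      have : u ∈ ((span ℂ (W' : Set ((Fin d₀' → ℂ) × (Fin d₁' → ℂ)))).map (LinearMap.fst ℂ _ _)).comap g₀ := by
        rw [htop]; trivial
      rw [Submodule.mem_comap, hu] at this
      exact this
    have h2 := Submodule.finrank_map_le (LinearMap.fst ℂ (Fin d₀' → ℂ) (Fin d₁' → ℂ))
      (span ℂ (W' : Set ((Fin d₀' → ℂ) × (Fin d₁' → ℂ))))
    rw [h1, finrank_top, Module.finrank_fin_fun] at h2
    exact h2.trans (Submodule.finrank_mono hspanW'le)
  -- `m := dim ℂ g₁(X) ≤ n'`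
  have hXg₁le : span ℂ (X.map (g₁.restrictScalars ℤ) : Set (Fin d₁' → ℂ)) ≤
      (span ℂ ((W' : Set ((Fin d₀' → ℂ) × (Fin d₁' → ℂ))) ∪ (Y' : Set _))).map (LinearMap.snd ℂ _ _) := by
    refine span_le.mpr ?_
    rintro _ ⟨ξ, hξ, rfl⟩
    obtain ⟨c, hcY, hc⟩ := hlift ξ hξ
    refine ⟨g (ofK K c, ξ), subset_span (Or.inr ⟨(ofK K c, ξ), hcY, rfl⟩), ?_⟩
    rw [hg_apply]; rfl
  have hm_le : Module.finrank ℂ (span ℂ (X.map (g₁.restrictScalars ℤ) : Set (Fin d₁' → ℂ))) ≤ n' :=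
    (Submodule.finrank_mono hXg₁le).trans (Submodule.finrank_map_le _ _)
  -- numerical consequences of Théorème 1.1: `d₁' > n' > 0` and `d₁ n' ≤ d₁' n`
  have hn'pos : 0 < n' := by omega
  have hd₁'n' : n' < d₁' := by omega
  have hkey : d₁ * n' ≤ d₁' * n := by
    -- from `d₁' (n + d₁ - 2 n) ≤ d₁ (d₀' + d₁' - 2 n')` and `d₀' ≤ n'`
    have h1 : d₁' * (d₁ - n) ≤ d₁ * (d₁' - n') := by
      have e1 : n + d₁ - 2 * n = d₁ - n := by omega
      rw [e1] at hineq1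
      exact hineq1.trans (Nat.mul_le_mul_left _ (by omega))
    have h2 : d₁' * (d₁ - n) + d₁' * n = d₁' * d₁ := by rw [← Nat.mul_add]; congr 1; omega
    have h3 : d₁ * (d₁' - n') + d₁ * n' = d₁ * d₁' := by rw [← Nat.mul_add]; congr 1; omega
    nlinarith
  -- (b): `d₁' = d₁`, `g₁` bijective
  have hd₁' : d₁' = d₁ := by
    by_contra hne
    have hlt' : d₁' < d₁ := lt_of_le_of_ne hd₁'d₁ hne
    exact hnot ⟨d₁', hlt', g₁, g₁₀, hg₁surj, hg₁₀, lt_of_le_of_lt hm_le hd₁'n',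
      (Nat.mul_le_mul_left _ hm_le).trans hkey⟩
  have hg₁inj : Function.Injective g₁ := by
    subst hd₁'
    exact (LinearMap.injective_iff_surjective (f := g₁)).mpr hg₁surj
  -- hence `m = n`, `n' = n`, `d₀' = n`, `g₀` bijective, `g` injective
  have hm_eq : Module.finrank ℂ (span ℂ (X.map (g₁.restrictScalars ℤ) : Set (Fin d₁' → ℂ))) = n := by
    have : span ℂ (X.map (g₁.restrictScalars ℤ) : Set (Fin d₁' → ℂ)) = (span ℂ (X : Set (Fin d₁ → ℂ))).map g₁ := by
      rw [Submodule.map_span]; rfl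
    rw [this, finrank_map_of_injective g₁ hg₁inj, hfr]
  have hn'n : n' = n := by
    have h1 : n ≤ n' := hm_eq ▸ hm_le
    have h2 : d₁ * n' ≤ d₁ * n := by rw [hd₁'] at hkey; exact hkey
    have h3 : n' ≤ n := Nat.le_of_mul_le_mul_left h2 hd₁
    omega
  have hd₀' : d₀' = n := by
    have h1 : d₁' * (d₁ - n) ≤ d₁ * (d₀' + d₁' - 2 * n') := by
      have e1 : n + d₁ - 2 * n = d₁ - n := by omega
      rw [e1] at hineq1; exact hineq1
    rw [hd₁', hn'n] at h1
    have h2 : d₁ - n ≤ d₀' + d₁ - 2 * n := Nat.le_of_mul_le_mul_left h1 hd₁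
    omega
  have hg₀inj : Function.Injective g₀ := by
    subst hd₀'
    exact (LinearMap.injective_iff_surjective (f := g₀)).mpr hg₀surj
  have hginj : Function.Injective g := by
    rintro ⟨u, v⟩ ⟨u', v'⟩ h
    rw [hg_apply, hg_apply] at h
    simp only [Prod.mk.injEq] at h
    rw [hg₀inj h.1, hg₁inj h.2]
  -- `ℓ₀' = n`, `ℓ₁' = rang X`, and `ℓ_a' > 0` when `X ∩ 𝓛 ≠ 0`
  have hℓ₀' : ℓ₀' = n := by
    have hKinj : Function.Injective (g.restrictScalars K) := hginj
    rw [hℓ₀'def, hW', finrank_map_of_injective _ hKinj, hW, LinearMap.finrank_range_of_inj hψinj,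
      Module.finrank_fin_fun]
  have hℓ₁' : ℓ₁' = Module.finrank ℤ ↥X := by
    have hZinj : Function.Injective (g.restrictScalars ℤ) := hginj
    rw [hℓ₁'def, hY', finrank_map_of_injective _ hZinj]
    exact LinearEquiv.finrank_eq hYX
  have hℓa' : (∃ x ∈ X, x ≠ 0 ∧ ∀ i, IsAlgebraic ℚ (cexp (x i))) → 0 < ℓa' := by
    rintro ⟨ξ, hξ, hξ0, hξalg⟩
    have hZinj : Function.Injective (g.restrictScalars ℤ) := hginj
    rw [hℓa'def, hYa', finrank_map_of_injective _ hZinj]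
    obtain ⟨c, hcY, hc⟩ := hlift ξ hξ
    have hmem : (ofK K c, ξ) ∈ Ya := (hmemYa _).mpr ⟨hcY, hξalg⟩
    haveI : Module.Finite ℤ Ya := Module.Finite.of_injective (Submodule.inclusion hYaY) (Submodule.inclusion_injective hYaY)
    haveI : Module.Free ℤ Ya := Module.free_of_finite_type_torsion_free'
    refine Module.finrank_pos_iff_exists_ne_zero.mpr ⟨⟨(ofK K c, ξ), hmem⟩, ?_⟩
    intro h0
    have := congrArg (fun p : Ya => (p : (Fin n → ℂ) × (Fin d₁ → ℂ)).2) h0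
    exact hξ0 (by simpa using this)
  -- conclusion
  rw [hn'n, hd₁', hd₀'] at hineq2 hstrict
  rw [show ℓ₀' = n from hℓ₀'] at hineq2 hstrict
  rw [show ℓ₁' = Module.finrank ℤ ↥X from hℓ₁'] at hineq2 hstrict
  have e2 : n + d₁ - 2 * n = d₁ - n := by omega
  have e3 : 2 * n - n = n := by omega
  rw [e2, e3] at hineq2 hstrict
  refine ⟨hn0, ?_, fun hXL => ?_⟩
  · -- `ℓ₁ (d₁ - n) ≤ d₁ n` ⇒ `ℓ₁ d₁ ≤ n (d₁ + ℓ₁)`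
    have : Module.finrank ℤ ↥X * (d₁ - n) + Module.finrank ℤ ↥X * n = Module.finrank ℤ ↥X * d₁ := by
      rw [← Nat.mul_add]; congr 1; omega
    nlinarith
  · have hs := hstrict (Or.inr (Or.inr (hℓa' hXL)))
    have : Module.finrank ℤ ↥X * (d₁ - n) + Module.finrank ℤ ↥X * n = Module.finrank ℤ ↥X * d₁ := by
      rw [← Nat.mul_add]; congr 1; omega
    nlinarith

/-! ### Corollaire 1.3 from Théorème 1.1 -/

set_option maxHeartbeats 800000 in
/-- **Corollaire 1.3 follows from Théorème 1.1 at transcendence degree `1`** (Roy–Waldschmidt 1997,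
pp. 758–759, as printed; the proof of `cor_1_3_of_thm_1_1` of `…Thm11.lean`:
strong induction on `d₁`, case (a) through a smaller `d₁'` with the rational map rescaled to an
integer matrix, case (b) = `cor_1_3_case_b`).  The conclusion is Corollaire 1.3 verbatim in the
rendering of `cor_1_4_of_cor_1_3`.
[cite: RoyWaldschmidt1997ENS, Théorème 1.1 pp. 755–756; Corollaire 1.3 and proof pp. 758–759] -/
theorem cor_1_3_of_thm_1_1_eq
    (h11 : ∀ (K : IntermediateField ℚ ℂ), Algebra.trdeg ℚ K = 1 →
      ∀ (d₀ d₁ : ℕ), 0 < d₀ + d₁ →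
      ∀ (W : Submodule K ((Fin d₀ → ℂ) × (Fin d₁ → ℂ))),
        (∀ w ∈ W, (∀ i, w.1 i ∈ K) ∧ (∀ j, w.2 j ∈ K)) →
      ∀ (Y : Submodule ℤ ((Fin d₀ → ℂ) × (Fin d₁ → ℂ))), Y.FG →
        (∀ y ∈ Y, (∀ i, y.1 i ∈ K) ∧ (∀ j, cexp (y.2 j) ∈ K)) →
      ∀ (Ya : Submodule ℤ ((Fin d₀ → ℂ) × (Fin d₁ → ℂ))), Ya ≤ Y →
        (∀ y ∈ Ya, ∀ j, IsAlgebraic ℚ (cexp (y.2 j))) →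
      2 * Module.finrank ℂ (span ℂ ((W : Set ((Fin d₀ → ℂ) × (Fin d₁ → ℂ))) ∪ (Y : Set _))) < d₀ + d₁ →
      (∀ (T₀ : Submodule ℂ (Fin d₀ → ℂ)) (T₁ : Submodule ℂ (Fin d₁ → ℂ)),
          IsKRational K T₀ → (∃ s : Set (Fin d₁ → ℚ), T₁ = ratSpan s) →
          (∀ w ∈ W, w.1 ∈ T₀ ∧ w.2 ∈ T₁) → (∀ y ∈ Y, y.1 ∈ T₀ ∧ y.2 ∈ T₁) → T₀ = ⊤ ∧ T₁ = ⊤) →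
      ∃ (d₀' d₁' : ℕ) (g : ((Fin d₀ → ℂ) × (Fin d₁ → ℂ)) →ₗ[ℂ] ((Fin d₀' → ℂ) × (Fin d₁' → ℂ))),
        0 < d₀' + d₁' ∧ Function.Surjective g ∧
        g '' {p | (∀ i, p.1 i ∈ K) ∧ p.2 = 0} = {q | (∀ i, q.1 i ∈ K) ∧ q.2 = 0} ∧
        g '' {p | p.1 = 0 ∧ ∀ j, p.2 j ∈ Set.range ((↑) : ℚ → ℂ)} =
          {q | q.1 = 0 ∧ ∀ j, q.2 j ∈ Set.range ((↑) : ℚ → ℂ)} ∧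
        2 * Module.finrank ℂ (span ℂ ((W.map (g.restrictScalars K) : Set ((Fin d₀' → ℂ) × (Fin d₁' → ℂ))) ∪
              (Y.map (g.restrictScalars ℤ) : Set _))) < d₀' + d₁' ∧
        Module.finrank K ↥(W.map (g.restrictScalars K)) <
          2 * Module.finrank ℂ (span ℂ ((W.map (g.restrictScalars K) : Set ((Fin d₀' → ℂ) × (Fin d₁' → ℂ))) ∪
              (Y.map (g.restrictScalars ℤ) : Set _))) ∧
        d₁' * (d₀ + d₁ - 2 * Module.finrank ℂ (span ℂ ((W : Set ((Fin d₀ → ℂ) × (Fin d₁ → ℂ))) ∪ (Y : Set _)))) ≤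
          d₁ * (d₀' + d₁' - 2 * Module.finrank ℂ (span ℂ ((W.map (g.restrictScalars K) :
              Set ((Fin d₀' → ℂ) × (Fin d₁' → ℂ))) ∪ (Y.map (g.restrictScalars ℤ) : Set _)))) ∧
        Module.finrank ℤ ↥(Y.map (g.restrictScalars ℤ)) *
            (d₀' + d₁' - 2 * Module.finrank ℂ (span ℂ ((W.map (g.restrictScalars K) :
              Set ((Fin d₀' → ℂ) × (Fin d₁' → ℂ))) ∪ (Y.map (g.restrictScalars ℤ) : Set _)))) ≤
          d₁' * (2 * Module.finrank ℂ (span ℂ ((W.map (g.restrictScalars K) :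
              Set ((Fin d₀' → ℂ) × (Fin d₁' → ℂ))) ∪ (Y.map (g.restrictScalars ℤ) : Set _))) -
            Module.finrank K ↥(W.map (g.restrictScalars K))) ∧
        ((d₀' < Module.finrank ℂ (span ℂ ((W.map (g.restrictScalars K) :
              Set ((Fin d₀' → ℂ) × (Fin d₁' → ℂ))) ∪ (Y.map (g.restrictScalars ℤ) : Set _))) ∨
          Module.finrank K ↥(W.map (g.restrictScalars K)) <
            Module.finrank ℂ (span ℂ ((W.map (g.restrictScalars K) :
              Set ((Fin d₀' → ℂ) × (Fin d₁' → ℂ))) ∪ (Y.map (g.restrictScalars ℤ) : Set _))) ∨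
          0 < Module.finrank ℤ ↥(Ya.map (g.restrictScalars ℤ))) →
          Module.finrank ℤ ↥(Y.map (g.restrictScalars ℤ)) *
              (d₀' + d₁' - 2 * Module.finrank ℂ (span ℂ ((W.map (g.restrictScalars K) :
                Set ((Fin d₀' → ℂ) × (Fin d₁' → ℂ))) ∪ (Y.map (g.restrictScalars ℤ) : Set _)))) <
            d₁' * (2 * Module.finrank ℂ (span ℂ ((W.map (g.restrictScalars K) :
                Set ((Fin d₀' → ℂ) × (Fin d₁' → ℂ))) ∪ (Y.map (g.restrictScalars ℤ) : Set _))) -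
              Module.finrank K ↥(W.map (g.restrictScalars K)))))
    :
    ∀ (K : IntermediateField ℚ ℂ), Algebra.trdeg ℚ K = 1 →
      ∀ (d : ℕ), 0 < d → ∀ (X : Submodule ℤ (Fin d → ℂ)), X.FG →
        (∀ x ∈ X, ∀ i, x i ∈ K ∧ cexp (x i) ∈ K) →
        Module.finrank ℂ (span ℂ (X : Set (Fin d → ℂ))) < d →
        (∀ s : Set (Fin d → ℚ), X ≤ (ratSpan s).restrictScalars ℤ → ratSpan s = ⊤) →
        ∃ (d' : ℕ) (g : (Fin d → ℂ) →ₗ[ℂ] (Fin d' → ℂ)) (g₀ : (Fin d → ℚ) →ₗ[ℚ] (Fin d' → ℚ)),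
          0 < d' ∧ Function.Surjective g ∧
          (∀ v : Fin d → ℚ, g (fun j => ((v j : ℚ) : ℂ)) = fun i => ((g₀ v i : ℚ) : ℂ)) ∧
          Module.finrank ℂ (span ℂ (X.map (g.restrictScalars ℤ) : Set (Fin d' → ℂ))) < d' ∧
          0 < Module.finrank ℂ (span ℂ (X.map (g.restrictScalars ℤ) : Set (Fin d' → ℂ))) ∧
          d * Module.finrank ℂ (span ℂ (X.map (g.restrictScalars ℤ) : Set (Fin d' → ℂ))) ≤
            d' * Module.finrank ℂ (span ℂ (X : Set (Fin d → ℂ))) ∧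
          Module.finrank ℤ ↥(X.map (g.restrictScalars ℤ)) * d' ≤
            Module.finrank ℂ (span ℂ (X.map (g.restrictScalars ℤ) : Set (Fin d' → ℂ))) *
              (d' + Module.finrank ℤ ↥(X.map (g.restrictScalars ℤ))) ∧
          ((∃ x ∈ X.map (g.restrictScalars ℤ), x ≠ 0 ∧ ∀ i, IsAlgebraic ℚ (cexp (x i))) →
            Module.finrank ℤ ↥(X.map (g.restrictScalars ℤ)) * d' <
              Module.finrank ℂ (span ℂ (X.map (g.restrictScalars ℤ) : Set (Fin d' → ℂ))) *
                (d' + Module.finrank ℤ ↥(X.map (g.restrictScalars ℤ)))) := by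
  classical
  intro K hK d
  induction d using Nat.strong_induction_on with
  | _ d ih =>
  intro hd X hX hXK hn hirr
  by_cases hA : ∃ d₁' : ℕ, d₁' < d ∧ ∃ (g : (Fin d → ℂ) →ₗ[ℂ] (Fin d₁' → ℂ))
      (g₀ : (Fin d → ℚ) →ₗ[ℚ] (Fin d₁' → ℚ)), Function.Surjective g ∧
      (∀ v : Fin d → ℚ, g (fun j => ((v j : ℚ) : ℂ)) = fun i => ((g₀ v i : ℚ) : ℂ)) ∧
      Module.finrank ℂ (span ℂ (X.map (g.restrictScalars ℤ) : Set (Fin d₁' → ℂ))) < d₁' ∧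
      d * Module.finrank ℂ (span ℂ (X.map (g.restrictScalars ℤ) : Set (Fin d₁' → ℂ))) ≤
        d₁' * Module.finrank ℂ (span ℂ (X : Set (Fin d → ℂ)))
  · -- case (a): induct through `d₁'`
    obtain ⟨d₁', hlt, g, g₀, hsurj, hrat, hn', hineq⟩ := hA
    -- rescale to an integer matrix
    obtain ⟨N, hN, hZ⟩ := exists_common_den (fun p : Fin d₁' × Fin d => g₀ (Pi.single p.2 1) p.1)
    choose Z hZ using hZ
    have hNC : (N : ℂ) ≠ 0 := by exact_mod_cast hN.ne'
    set G : (Fin d → ℂ) →ₗ[ℂ] (Fin d₁' → ℂ) := (N : ℂ) • g with hG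
    set G₀ : (Fin d → ℚ) →ₗ[ℚ] (Fin d₁' → ℚ) := (N : ℚ) • g₀ with hG₀
    have hGrat : ∀ v : Fin d → ℚ, G (fun j => ((v j : ℚ) : ℂ)) = fun i => ((G₀ v i : ℚ) : ℂ) := by
      intro v
      rw [hG, LinearMap.smul_apply, hrat, hG₀]
      funext i; simp
    have hGsurj : Function.Surjective G := by
      intro y
      obtain ⟨x, hx⟩ := hsurj y
      refine ⟨(N : ℂ)⁻¹ • x, ?_⟩
      rw [hG, LinearMap.smul_apply, map_smul, hx, smul_smul, mul_inv_cancel₀ hNC, one_smul]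
    have hGcoord : ∀ x : Fin d → ℂ, ∀ i, G x i = ∑ j, ((Z (i, j) : ℤ) : ℂ) * x j := by
      intro x i
      rw [apply_eq_sum_of_rat G G₀ hGrat x i]
      refine Finset.sum_congr rfl fun j _ => ?_
      congr 1
      have := hZ (i, j)
      simp only at this
      rw [hG₀, LinearMap.smul_apply, Pi.smul_apply, smul_eq_mul, this]
      simp
    set X' : Submodule ℤ (Fin d₁' → ℂ) := X.map (G.restrictScalars ℤ) with hX'
    have hX'fg : X'.FG := hX.map _
    have hX'K : ∀ x ∈ X', ∀ i, x i ∈ K ∧ cexp (x i) ∈ K := by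
      rintro _ ⟨x, hx, rfl⟩ i
      rw [LinearMap.restrictScalars_apply, hGcoord x i]
      exact ⟨Subalgebra.sum_mem _ fun j _ => mul_mem (intCast_mem _ _) (hXK x hx j).1,
        cexp_sum_int_mul_mem K _ fun j => (hXK x hx j).2⟩
    have hspanX' : span ℂ (X' : Set (Fin d₁' → ℂ)) = span ℂ (X.map (g.restrictScalars ℤ) : Set (Fin d₁' → ℂ)) :=
      span_map_smul_eq X g hNC
    have hn'X' : Module.finrank ℂ (span ℂ (X' : Set (Fin d₁' → ℂ))) < d₁' := by rw [hspanX']; exact hn'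
    have hd₁'pos : 0 < d₁' := lt_of_le_of_lt (Nat.zero_le _) hn'X'
    have hirr' : ∀ s : Set (Fin d₁' → ℚ), X' ≤ (ratSpan s).restrictScalars ℤ → ratSpan s = ⊤ := by
      intro s hs
      have hGofK : ∀ v : Fin d → ℚ, G (ofK ℚ v) = ofK ℚ (G₀ v) := by
        intro v; rw [ofK_rat_eq, ofK_rat_eq, hGrat]
      have hrs : IsKRational ℚ (ratSpan s) := isKRational_ratSpan s
      obtain ⟨s'', hs''⟩ := IsKRational.comap_of_ofK G G₀ hGofK hrs
      have hs''eq : (ratSpan s).comap G = ratSpan s'' := hs''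
      have hXle : X ≤ (ratSpan s'').restrictScalars ℤ := by
        intro x hx
        rw [Submodule.restrictScalars_mem, ← hs''eq, Submodule.mem_comap]
        exact hs ⟨x, hx, rfl⟩
      have htop := hirr s'' hXle
      rw [← hs''eq] at htop
      refine eq_top_iff.mpr fun y _ => ?_
      obtain ⟨x, rfl⟩ := hGsurj y
      have : x ∈ (ratSpan s).comap G := by rw [htop]; trivial
      exact this
    obtain ⟨d'', g', g'₀, hd''pos, hsurj', hrat', hn''lt, hn''pos, hineq', hineq2', hstrict'⟩ :=
      ih d₁' hlt hd₁'pos X' hX'fg hX'K hn'X' hirr'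
    have hmap : X.map ((g'.comp G).restrictScalars ℤ) = X'.map (g'.restrictScalars ℤ) := by
      rw [hX', ← Submodule.map_comp]; rfl
    refine ⟨d'', g'.comp G, g'₀.comp G₀, hd''pos, hsurj'.comp hGsurj, fun v => ?_, ?_, ?_, ?_, ?_, ?_⟩
    · rw [LinearMap.comp_apply, hGrat, hrat']; rfl
    · rw [hmap]; exact hn''lt
    · rw [hmap]; exact hn''pos
    · rw [hmap]
      rw [hspanX'] at hineq'
      set m := Module.finrank ℂ (span ℂ (X.map (g.restrictScalars ℤ) : Set (Fin d₁' → ℂ))) with hm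
      set n'' := Module.finrank ℂ (span ℂ (X'.map (g'.restrictScalars ℤ) : Set (Fin d'' → ℂ))) with hn''
      set n := Module.finrank ℂ (span ℂ (X : Set (Fin d → ℂ))) with hnn
      have hn''m : n'' ≤ m := by
        rw [hm, ← hspanX', hn'']
        have : span ℂ (X'.map (g'.restrictScalars ℤ) : Set (Fin d'' → ℂ)) = (span ℂ (X' : Set (Fin d₁' → ℂ))).map g' := by
          rw [Submodule.map_span]; rfl
        rw [this]; exact Submodule.finrank_map_le _ _
      have hmpos : 0 < m := lt_of_lt_of_le hn''pos hn''m
      have h1 : d * n'' * (d₁' * m) ≤ d'' * n * (d₁' * m) := by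
        calc d * n'' * (d₁' * m) = (d * m) * (d₁' * n'') := by ring
          _ ≤ (d₁' * n) * (d'' * m) := Nat.mul_le_mul hineq hineq'
          _ = d'' * n * (d₁' * m) := by ring
      exact Nat.le_of_mul_le_mul_right h1 (Nat.mul_pos hd₁'pos hmpos)
    · rw [hmap]; exact hineq2'
    · rw [hmap]; exact hstrict'
  · -- case (b)
    obtain ⟨hn0, hineq, hstrict⟩ := cor_1_3_case_b_eq h11 K hK d hd X hX hXK hn hirr hA
    have hid : X.map ((LinearMap.id : (Fin d → ℂ) →ₗ[ℂ] (Fin d → ℂ)).restrictScalars ℤ) = X := by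
      have : (LinearMap.id : (Fin d → ℂ) →ₗ[ℂ] (Fin d → ℂ)).restrictScalars ℤ = LinearMap.id := rfl
      rw [this, Submodule.map_id]
    refine ⟨d, LinearMap.id, LinearMap.id, hd, Function.surjective_id, fun v => rfl, ?_, ?_, ?_, ?_, ?_⟩
    · rw [hid]; exact hn
    · rw [hid]; exact hn0
    · rw [hid]
    · rw [hid]; exact hineq
    · rw [hid]; exact hstrict


/-! ### The named fact from Théorème 5.1 -/

/-- **`royWaldschmidt_quadratic_thm_0_2` (Théorème 0.2 of Roy–Waldschmidt 1997) follows from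
Théorème 5.1 of the paper** — in the tangent-space form `h51all` used on pp. 788–789 (see the module
docstring of `…Sec6IVa.lean`: for `K` finitely generated of transcendence degree `1` and an object
`(d₀, d₁, W, Y, Y_a)` with `d > 0`, a surjective `g = T(G → G/L)`, `L ≠ G` connected defined over `K`,
satisfying (5.1) for all `0 < ε ≤ (2d(d+λ)+1)⁻¹`) — everything else being proved in this series:
§6 (Proposition 6.1 after Roy 1992, the category `𝒞`, Lemmes 6.2–6.4, (iv) (a), (iv) (b)) gives
Théorème 1.1 (`thm_1_1_of_thm_5_1`), §1 gives Corollaire 1.3 (`cor_1_3_of_thm_1_1_eq`) and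
Corollaire 1.4, Théorème 0.1 and §7 give Théorème 0.2 (`royWaldschmidt_quadratic_thm_0_2_of_cor_1_3`).
[cite: RoyWaldschmidt1997ENS, Théorème 5.1 p. 779; §6 pp. 785–790; §1 pp. 755–760; §7] -/
theorem royWaldschmidt_quadratic_thm_0_2_of_thm_5_1
    (h51all : ∀ (K : IntermediateField ℚ ℂ), K.FG → Algebra.trdeg ℚ K = 1 → ∀ X : RWObj K, 0 < X.d₀ + X.d₁ →
      ∃ (d₀' d₁' : ℕ) (g : ((Fin X.d₀ → ℂ) × (Fin X.d₁ → ℂ)) →ₗ[ℂ] ((Fin d₀' → ℂ) × (Fin d₁' → ℂ))),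
        IsStruct K g ∧ Function.Surjective g ∧
        (∀ z : Fin X.d₁ → ℤ, ∃ z' : Fin d₁' → ℤ, g (0, fun j => (z j : ℂ)) = (0, fun j => (z' j : ℂ))) ∧
        0 < d₀' + d₁' ∧
        ∀ ε : ℝ, 0 < ε → ε ≤ 1 / (2 * ((X.d₀ : ℝ) + X.d₁) * (((X.d₀ : ℝ) + X.d₁) + ((X.ell₁ : ℝ) - X.kap)) + 1) →
          ((((X.d₀ : ℝ) + X.d₁) - 2 * X.nn) + ε * ((X.nn : ℝ) - X.d₀)) *
              ((d₁' : ℝ) + ((Module.finrank ℤ ↥(X.Y.map (g.restrictScalars ℤ)) : ℝ) -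
                Module.finrank ℤ ↥(X.Y.map (g.restrictScalars ℤ) ⊓ omegaLattice d₀' d₁'))) ≤
            (X.d₁ : ℝ) * ((((d₀' : ℝ) + d₁') - Module.finrank K ↥(X.W.map (g.restrictScalars K))) +
              ε * ((Module.finrank K ↥(X.W.map (g.restrictScalars K)) : ℝ) - d₀') -
              ε ^ 2 * ((Module.finrank ℤ ↥(X.Ya.map (g.restrictScalars ℤ)) : ℝ) -
                Module.finrank ℤ ↥(X.Ya.map (g.restrictScalars ℤ) ⊓ omegaLattice d₀' d₁')))) :
    royWaldschmidt_quadratic_thm_0_2 :=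
  royWaldschmidt_quadratic_thm_0_2_of_cor_1_3 (cor_1_3_of_thm_1_1_eq (thm_1_1_of_thm_5_1 h51all))

end RoyWaldschmidt1997

end Literature.NumberTheory.Transcendental
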